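/-
Copyright (c) 2026 the pub-hodgecm-mathlib formalisation cell (harness21).  Prover seat hodgecm-mathlib-K2E3-p36 (g0), HCML Track B «K2-LIT» (build stream 29),
h413 = `stmt-HodgeConjecture-24833`, line `K2_E3_EllipticInputs`, unit U12 «Characters», PART «SC» leaf (SC-an)₂ `sig_K2E3SupercuspidalTruncatedCharAnalyticTwo`, the
(M5h₂) chain (LINE-LEAD K2E3-plan (g4), L4 EMIT #2, `K2/STATUS.md` 2026-09-04T14:55:54Z): piece [M6′]₂ «EXPLICIT Bset» AT `U(1,1)`, FILE A (MODEL SIDE) — the `Fin 2` twin of ★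
[M6′] `K2E3SupercuspidalTruncatedCharRadiusDatum` (K2E5-p04 (g3)), HYPOTHESIS-FIRST over the four not-yet-ported `2 × 2` inputs (d)₂, (D2a)₂, (D2b)₂, (M5d)₂.  2026-09-04.
-/
import Summits.HodgeConjecture.HodgeConjecture.Theorems.K2E3SupercuspidalTruncatedCharLimCanc        -- ★ [M6] p856884: §1 GENERIC `exists_forall_setIntegral_sdiff_eq_zero_of_subset`; brings ★ [M2a] FILE A (N-agnostic heads), ★ `exists_isCompact_subset_mul_of_isCompact_image_mk`, ★ Lemma 14 (generic `m`), ★ `hasCompactSupport_sesqForm_apply_apply`, ★ `AdicCompletionLocalField`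
import Summits.HodgeConjecture.HodgeConjecture.Theorems.K2E3SupercuspModelFrameAtPlaceTwo              -- ★ [M2a]₂ FILE A p861132 (K2E3-p31): `isCompact_center_of_eq_over`, `exists_coe_eq_scalar_of_mem_center`, `locallyCompactSpace_unitaryGroupOfForm_adicCompletion`, `isMulRightInvariant_of_isHaarMeasure_of_eq_over` at `Φ₂`
import Summits.HodgeConjecture.HodgeConjecture.Theorems.F0P3cStCharTSWeylHypFibre                      -- ★ `isUnit_sub_of_isRegularElt_glDiagonal` (regular diagonal ⇒ distinct eigenvalues; `Fin N`-generic)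
import Literature.NumberTheory.Automorphic.UnitaryThreeTorusDoubleCosetsHK                              -- ★ `exists_v_pow_mul_le_one` (`|ϖ^N x| ≤ 1` for `N ≫ 0`)
import HarnessLib

/-!
# h413 ∕ Track B «K2-LIT», line `K2_E3_EllipticInputs`, unit U12, leaf (SC-an)₂, (M5h₂) chain — piece [M6′]₂ «EXPLICIT Bset» AT `U(1,1)`, FILE A (MODEL SIDE): AN EXPLICIT RADIUS
# `5 m_C + 3 s + 1` FOR THE TRUNCATED SUPERCUSPIDAL CHARACTER AT EVERY SPLIT-REGULAR ELEMENT OF `U(σ_w, Φ₂)(L_w)`, WITH ITS DATUM `(t, d, λ, y₀, m_g)` — HYPOTHESIS-FIRST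
# (Harish-Chandra 1970, Part VII §3 p. 71 eq. (1), (ii), p. 72; Theorem 20; Cor. of Theorem 18 — for `U(1,1)`)

Cell `pub/hodgecm-mathlib`, crux H413 = `stmt-HodgeConjecture-24833`, route of record `HCCMUnconditional`; chair K2-lead (g2), LINE-LEAD ∕ dealer K2E3-plan (g4), (M5h₂) chain desk
K2E3-p27 (g0), binder desk K2E3-p23 (g7), architect K2E3-p25 (g3).  THEOREMS ONLY (no `def`, no `instance`, no `notation`, no named-fact hypothesis, no `sorry`); lane
`--supports stmt-HodgeConjecture-24833 --as helper`, count-neutral.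

WHAT THIS FILE IS.  The `Fin 2` twin of ★ [M6′] FILE A `K2E3SupercuspidalTruncatedCharRadiusDatum.exists_radius_and_datum` (`U(2,1)`): along the field model `M = U(σ_w, Φ₂)(L_w)` of
the (SC-an)₂ leaf, with height balls `Ω_M` (★ p856390's `hmem` `hinv` `hmul`, INPUT), for every `m ∈ M` ONE radius `R` such that (i) if `m` is regular, `∫_{Ω n ∖ Ω R} θ_M(x m x⁻¹) dμ = 0`
for every `n`; (ii) if `m` is regular with NON-compact centraliser, `R = 5(2m_θ + 2λ) + 3(2m_g + 2λ) + 1` for a DATUM `(t, d, y₀, λ, m_g)`: `t = diag d` regular, `λ` the MINIMAL depth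
of `t` (`∀ i ≠ k, |ϖ^λ| ≤ |dᵢ − dₖ|`), `m_g` the MINIMAL height of `m` (Mathlib `CompactExhaustion.find`), `y₀ ∈ Ω (2m_g + 2λ)`, `m = y₀ t y₀⁻¹`.  The composition is the template's,
token for token (`Fin 3 ↦ Fin 2`, `Φ₃ ↦ Φ₂`); the statements below keep the `N = 3` constants `2m + 2λ`, `2m_θ + 2λ`, `m_C + (1 + 2s + 4m_C) + s` VERBATIM (the rank-free ★
`K2E3CuspFormCancellation{Core,Heights,LevelOne}` fix Theorem 20's radius shape at every rank, cf. ★ `K2E3CuspFormCancellationU2Torus`).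

HYPOTHESIS-FIRST (L4 EMIT #2: «if its inputs (M5d)∕(D2)∕[M4]₂ are not yet ported, type it HYPOTHESIS-FIRST over named letters = the missing twins' head statements»).  Of the
template's five ★ inputs, TWO are available at `2 × 2` and are used BY NAME — ★ [M2a]₂ FILE A (`hZc`, `hZs`, local compactness, right invariance) and the regular-ELLIPTIC
shell vanishing, which is `n`-generic (★ Lemma 14 `UnitaryGroupOfForm.isCompact_image_mk_setOf_exists_conj_mem_of_charpoly_separable (m := 2)`, ★
`IsSupercuspidal.hasCompactSupport_sesqForm_apply_apply`, ★ `exists_isCompact_subset_mul_of_isCompact_image_mk`, ★ [M6] §1) and is PAID here (§2) —; the THREE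
split-type inputs are ∀-CLOSED LETTERS whose texts are the heads of the not-yet-written `Fin 2` twins, token for token:
* `hCART` = (d)₂ `K2E3SupercuspModelFrameAtPlaceCartanTwo.exists_conj_torusU_of_not_isCompact_centralizer` (★ [M2a] FILE B (d) :74 with `3 ↦ 2`; K2E3-p31 (g0), in flight),
  over the PLACE frame `(L : Type) … (w) (hw) {J} (hJ) {g} (hreg) (hnc)`;
* `hD2a` = (D2a)₂ `…ConjugatorHeightControlRankOne….exists_conjugator_mem_heightBall` and `hD2b` = (D2b)₂ `….mem_heightBall_mul_torusU_of_conj_mem_support` (★ [M5](D2) :370 ∕ :382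
  with `3 ↦ 2`), over the MODEL frame `(K : Type) [Field K] [Valued K ℤᵐ⁰] (σ) (hσv) (hσσ) {J} (hJ) {ϖ} (hϖ) (Ω : ℕ → Set U) (hmem)` (the template's §2 `variable` block, in order);
* `hM5d` = (M5d)₂ `…Thm20RadiusTwo.setIntegral_sdiff_heightBall_coeff_conj_eq_zero_of_subset` (★ (M5d) :61 with `3 ↦ 2`; K2E3-p14 (g8) FILE 2), over its full binder list
  (`{V : Type u}` shares this file's universe `u`).
The only instantiation is `K := L_w`, `σ := σ_w`; a porter whose head MATCHES these bytes discharges the letter BY NAME.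

* §1 `exists_depth_of_isRegularElt` — a regular `t = diag d ∈ GL₂` has a depth `λ` (`|ϖ^λ| ≤ |d₀ − d₁|`, `|ϖ^λ| ≤ |d₁ − d₀|`).
* §2 `exists_forall_setIntegral_sdiff_coeff_conj_eq_zero_of_isCompact_centralizer` — the regular-ELLIPTIC shell vanishing on `U(σ_w, Φ₂)(L_w)`, LETTER-FREE (★ [M6] §2's
  elliptic half at `m := 2`).
* §3 **`exists_radius_and_datum`** — the [M6′]₂ head over the four letters.

HONEST LABEL.  HC_CM is proved only modulo the 7 printed citations (2 remaining named inputs: hLiu418 = `stmt-HodgeConjecture-24832`, h413 = `stmt-HodgeConjecture-24833`)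
until rung 0 closes; count-neutral helper; [M6′]₂ is RELATIVE to exactly {(d)₂, (D2a)₂, (D2b)₂, (M5d)₂} — NOT ★-closed — and (SC-an)₂ is not ★ until COLL₂ + NC₂ + the whole
(M5h₂) chain land.

## References
* [HarishChandra1970] Harish-Chandra (notes by G. van Dijk), *Harmonic Analysis on Reductive p-adic Groups*, LNM 162 (1970), Part VII §2 Theorem 20 p. 70, Cor. of Thm 18 p. 69;
  §3 p. 71 eq. (1), (ii), p. 72; Part I §3 Lemma 14 p. 9; Part V Lemma 42.
* [Rogawski1990] J. D. Rogawski, *Automorphic Representations of Unitary Groups in Three Variables*, Ann. of Math. Stud. 123 (1990), §3.1 p. 19, §3.6 pp. 28–31, §4.9 p. 54,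
  §12.2 p. 173, §12.5 p. 182.
* [PlatonovRapinchuk1994] V. Platonov, A. Rapinchuk, *Algebraic Groups and Number Theory* (1994), §5.1.
* [Folland1995] G. B. Folland, *A Course in Abstract Harmonic Analysis* (1995), §2.4.
-/

set_option autoImplicit false
-- the mandated namespace repeats the single-problem summit's segment (`HodgeConjecture.HodgeConjecture`)
set_option linter.dupNamespace false

noncomputable section

open MeasureTheory Measure Set Filter Topology NumberField IsDedekindDomain
open scoped NNReal ENNReal Pointwise Matrix MatrixGroups WithZero
open ValuativeRel
open Literature.NumberTheory.Automorphic Literature.NumberTheory.Automorphic.UnitaryGroup Literature.NumberTheory.Rogawski1990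
open Literature.NumberTheory.GaloisRepresentations

universe u

namespace Summit.HodgeConjecture.HodgeConjecture.Cruxes.H413.K2E3SupercuspidalTruncatedCharRadiusDatumTwo

/-! ## §1 A regular diagonal element of `GL₂` has a depth -/

/-- **A REGULAR DIAGONAL ELEMENT HAS A DEPTH** (`2 × 2`): for `t = diag d ∈ GL₂(K)` regular (distinct eigenvalues, ★ `isUnit_sub_of_isRegularElt_glDiagonal`) and `|ϖ| = exp(−1)`
there is `λ` with `|ϖ^λ| ≤ |dᵢ − dₖ|` for all `i ≠ k` (★ `exists_v_pow_mul_le_one` on the two inverse differences).  The `Fin 2` twin of ★ [M6′] §1.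
[cite: HarishChandra1970, Part VII §2 p. 69] [cite: Rogawski1990, §3.1 p. 19] -/
theorem exists_depth_of_isRegularElt {K : Type*} [Field K] [Valued K ℤᵐ⁰] {ϖ : K} (hϖ : Valued.v ϖ = WithZero.exp (-1 : ℤ))
    {d : Fin 2 → Kˣ} (hreg : IsRegularElt (glDiagonal 2 K d)) :
    ∃ lam : ℕ, ∀ i k : Fin 2, i ≠ k → Valued.v (ϖ ^ lam) ≤ Valued.v ((d i : K) - d k) := by
  -- one exponent per ordered pair, then the maximum
  have hpair : ∀ i k : Fin 2, i ≠ k → ∃ N : ℕ, ∀ M : ℕ, N ≤ M → Valued.v (ϖ ^ M) ≤ Valued.v ((d i : K) - d k) := by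
    intro i k hik
    have hne : ((d i : K) - d k) ≠ 0 := (F0P3cStCharTSWeylHypFibre.isUnit_sub_of_isRegularElt_glDiagonal hreg hik).ne_zero
    obtain ⟨N, hN⟩ := exists_v_pow_mul_le_one hϖ (((d i : K) - d k)⁻¹)
    refine ⟨N, fun M hM => ?_⟩
    have h := hN M hM
    rw [map_mul, map_inv₀] at h
    have hv0 : Valued.v ((d i : K) - d k) ≠ 0 := (Valuation.ne_zero_iff _).2 hne
    rwa [mul_inv_le_iff₀ (pos_iff_ne_zero.2 hv0), one_mul] at h
  choose N hN using hpair
  refine ⟨Finset.univ.sup fun p : Fin 2 × Fin 2 => if h : p.1 ≠ p.2 then N p.1 p.2 h else 0, fun i k hik => hN i k hik _ ?_⟩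
  have h1 : (if h : (i, k).1 ≠ (i, k).2 then N (i, k).1 (i, k).2 h else 0) = N i k hik := dif_pos hik
  rw [← h1]
  exact Finset.le_sup (f := fun p : Fin 2 × Fin 2 => if h : p.1 ≠ p.2 then N p.1 p.2 h else 0) (Finset.mem_univ (i, k))

/-! ## §2 The model `M = U(σ_w, Φ₂)(L_w)`: shell vanishing at a regular ELLIPTIC element (letter-free) -/

section Model

variable (L : Type) [Field L] [NumberField L] [IsCMField L] {v : HeightOneSpectrum (𝓞 ↥(maximalRealSubfield L))}
  (w : PlacesOver L v) (hw : IsCMField.complexConj L • w.1 = w.1)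

/-- **SHELL VANISHING AT A REGULAR ELLIPTIC ELEMENT OF `U(σ_w, Φ₂)(L_w)`**: for `θ_M = B u′ (ρ(·) u)` a coefficient of a smooth SUPERCUSPIDAL `ρ` (`B` invariant), `μ` a measure,
`Ω` a compact exhaustion and `m` REGULAR with COMPACT centraliser, ONE radius `R` gives `∫_{Ω n ∖ Ω R} θ_M(x m x⁻¹) dμ(x) = 0` for every `n`: the integrand is supported in the
COMPACT `{x ∣ x m x⁻¹ ∈ supp θ_M}` (Harish-Chandra's Lemma 14 at the model ★ `UnitaryGroupOfForm.isCompact_image_mk_setOf_exists_conj_mem_of_charpoly_separable (m := 2)`, compact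
support ★ `IsSupercuspidal.hasCompactSupport_sesqForm_apply_apply` from the compact centre ★ [M2a]₂ `isCompact_center_of_eq_over`, ★ `exists_isCompact_subset_mul_of_isCompact_image_mk`)
and ★ [M6] §1 `exists_forall_setIntegral_sdiff_eq_zero_of_subset` applies.  The elliptic half of ★ [M6] `exists_forall_setIntegral_sdiff_coeff_conj_eq_zero_of_isRegularElt` at `2 × 2`.
[cite: HarishChandra1970, Part I §3 Lemma 14 p. 9; Part VII §3 p. 71 eq. (1), p. 72] [cite: Rogawski1990, §4.9 p. 54, §12.2 p. 173] -/
theorem exists_forall_setIntegral_sdiff_coeff_conj_eq_zero_of_isCompact_centralizer {J : Matrix (Fin 2) (Fin 2) (w.1.adicCompletion L)}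
    (hJ : J = (StdForm.antidiagonal 2).over (w.1.adicCompletion L))
    [MeasurableSpace ↥(unitaryGroupOfForm (galAdicCompletionMap (L := L) (IsCMField.complexConj L) hw) J)]
    (μ : Measure ↥(unitaryGroupOfForm (galAdicCompletionMap (L := L) (IsCMField.complexConj L) hw) J))
    (Ω : CompactExhaustion ↥(unitaryGroupOfForm (galAdicCompletionMap (L := L) (IsCMField.complexConj L) hw) J))
    {V : Type*} [AddCommGroup V] [Module ℂ V]
    (ρ : Representation ℂ ↥(unitaryGroupOfForm (galAdicCompletionMap (L := L) (IsCMField.complexConj L) hw) J) V) (hsm : ρ.IsSmooth) (hsc : ρ.IsSupercuspidal)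
    (B : V →ₗ⋆[ℂ] V →ₗ[ℂ] ℂ)
    (hBinv : ∀ (g : ↥(unitaryGroupOfForm (galAdicCompletionMap (L := L) (IsCMField.complexConj L) hw) J)) (x y : V), B (ρ g x) (ρ g y) = B x y) (u u' : V)
    (m : ↥(unitaryGroupOfForm (galAdicCompletionMap (L := L) (IsCMField.complexConj L) hw) J)) (hreg : IsRegularElt (m : GL (Fin 2) (w.1.adicCompletion L)))
    (hZ : IsCompact ((Subgroup.centralizer ({m} : Set ↥(unitaryGroupOfForm (galAdicCompletionMap (L := L) (IsCMField.complexConj L) hw) J)) :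
      Subgroup ↥(unitaryGroupOfForm (galAdicCompletionMap (L := L) (IsCMField.complexConj L) hw) J)) :
        Set ↥(unitaryGroupOfForm (galAdicCompletionMap (L := L) (IsCMField.complexConj L) hw) J))) :
    ∃ R : ℕ, ∀ n : ℕ, ∫ x in Ω n \ Ω R, B u' (ρ (x * m * x⁻¹) u) ∂μ = 0 := by
  -- the frame of `L_w`, `GL₂(L_w)` and `M` (★ [M2a] FILE A ∕ [M2a]₂ FILE A; ★ `AdicCompletionLocalField` instances)
  haveI : SecondCountableTopology (w.1.adicCompletion L) := secondCountableTopology_adicCompletion L w.1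
  haveI : CharZero (w.1.adicCompletion L) := charZero_of_injective_algebraMap (algebraMap L (w.1.adicCompletion L)).injective
  haveI : SecondCountableTopology (GL (Fin 2) (w.1.adicCompletion L)) := secondCountableTopology_gl_adicCompletion L 2 w.1
  haveI : LocallyCompactSpace (GL (Fin 2) (w.1.adicCompletion L)) := locallyCompactSpace_gl_adicCompletion L 2 w.1
  haveI : SigmaCompactSpace (GL (Fin 2) (w.1.adicCompletion L)) := sigmaCompactSpace_of_locallyCompact_secondCountable
  haveI : LocallyCompactSpace ↥(unitaryGroupOfForm (galAdicCompletionMap (L := L) (IsCMField.complexConj L) hw) J) :=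
    K2E3SupercuspModelFrameAtPlaceTwo.locallyCompactSpace_unitaryGroupOfForm_adicCompletion L w hw J
  have hσσ : ∀ x, galAdicCompletionMap (L := L) (IsCMField.complexConj L) hw (galAdicCompletionMap (L := L) (IsCMField.complexConj L) hw x) = x :=
    galAdicCompletionMap_galAdicCompletionMap_of_smul_eq (IsCMField.complexConj L) w (IsCMField.complexConj_ne_one L) hw
  have hσc : Continuous (galAdicCompletionMap (L := L) (IsCMField.complexConj L) hw) := continuous_galAdicCompletionMap L (IsCMField.complexConj L) hw
  have hZc := K2E3SupercuspModelFrameAtPlaceTwo.isCompact_center_of_eq_over L w hw hJ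
  subst hJ
  letI : NontriviallyNormedField (w.1.adicCompletion L) := Valued.toNontriviallyNormedField (w.1.adicCompletion L) (WithZero (Multiplicative ℤ))
  -- the coefficient has compact support (compact centre)
  have hθ : HasCompactSupport fun g : ↥(unitaryGroupOfForm (galAdicCompletionMap (L := L) (IsCMField.complexConj L) hw)
      ((StdForm.antidiagonal 2).over (w.1.adicCompletion L))) => B u' (ρ g u) :=
    hsc.hasCompactSupport_sesqForm_apply_apply hZc hsm hBinv u u'
  -- Harish-Chandra's Lemma 14 at the model, `K = {m}`, `C = tsupport θ_M` (`Φ₂` hermitian with unit determinant: ★ `StdForm.over_map`, `transpose_over`, `isUnit_over`)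
  have hA := UnitaryGroupOfForm.isCompact_image_mk_setOf_exists_conj_mem_of_charpoly_separable (m := 2) two_ne_zero hσc hσσ
    (J := (StdForm.antidiagonal 2).over (w.1.adicCompletion L)) (by rw [StdForm.over_map, StdForm.transpose_over])
    ((Matrix.isUnit_iff_isUnit_det _).1 ((StdForm.antidiagonal 2).isUnit_over _)) m hreg isCompact_singleton
    (Set.singleton_subset_iff.2 (Subgroup.mem_centralizer_singleton_iff.2 rfl)) (fun t' ht' => by rw [Set.mem_singleton_iff.1 ht']; exact hreg) hθ.isCompact
  have hset : {x : ↥(unitaryGroupOfForm (galAdicCompletionMap (L := L) (IsCMField.complexConj L) hw) ((StdForm.antidiagonal 2).over (w.1.adicCompletion L))) |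
      ∃ t' ∈ ({m} : Set _), x * t' * x⁻¹ ∈ tsupport fun g : ↥(unitaryGroupOfForm (galAdicCompletionMap (L := L) (IsCMField.complexConj L) hw)
        ((StdForm.antidiagonal 2).over (w.1.adicCompletion L))) => B u' (ρ g u)} =
      {x | x * m * x⁻¹ ∈ tsupport fun g : ↥(unitaryGroupOfForm (galAdicCompletionMap (L := L) (IsCMField.complexConj L) hw)
        ((StdForm.antidiagonal 2).over (w.1.adicCompletion L))) => B u' (ρ g u)} := by
    ext x; simp only [Set.mem_setOf_eq, Set.mem_singleton_iff, exists_eq_left]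
  rw [hset] at hA
  obtain ⟨C, hC, hsub⟩ := K2E3UnipotentConjTwistBochner.exists_isCompact_subset_mul_of_isCompact_image_mk (Subgroup.centralizer {m}) hA
  -- the support set is closed, inside the compact `C · Z(m)`
  have hScl : IsClosed {x : ↥(unitaryGroupOfForm (galAdicCompletionMap (L := L) (IsCMField.complexConj L) hw) ((StdForm.antidiagonal 2).over (w.1.adicCompletion L))) |
      x * m * x⁻¹ ∈ tsupport fun g : ↥(unitaryGroupOfForm (galAdicCompletionMap (L := L) (IsCMField.complexConj L) hw)
        ((StdForm.antidiagonal 2).over (w.1.adicCompletion L))) => B u' (ρ g u)} :=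
    (isClosed_tsupport _).preimage ((continuous_id.mul continuous_const).mul continuous_inv)
  have hScpt := (hC.mul hZ).of_isClosed_subset hScl hsub
  refine K2E3SupercuspidalTruncatedCharLimCanc.exists_forall_setIntegral_sdiff_eq_zero_of_subset μ Ω _ hScpt fun x hx => ?_
  exact image_eq_zero_of_notMem_tsupport (f := fun g : ↥(unitaryGroupOfForm (galAdicCompletionMap (L := L) (IsCMField.complexConj L) hw)
    ((StdForm.antidiagonal 2).over (w.1.adicCompletion L))) => B u' (ρ g u)) fun hx' => hx hx'

/-! ## §3 A radius for every element of the model, with the datum read off at split-regular elements — over the four `2 × 2` letters -/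

open scoped Classical in
/-- **A RADIUS FOR EVERY ELEMENT OF THE MODEL `U(σ_w, Φ₂)(L_w)`, WITH THE DATUM READ OFF AT SPLIT-REGULAR ELEMENTS — HYPOTHESIS-FIRST.**  `M = U(σ_w, J)(L_w)`, `J = Φ₂`; `Ω` the
height-ball exhaustion (★ p856390's `hmem` `hinv` `hmul`); `θ_M = B u′ (ρ(·) u)` a coefficient of a smooth SUPERCUSPIDAL `ρ` of `M` (`B` invariant) supported in `Ω m_θ`; `μ` a Haar measure.
LETTERS (∀-closed, the heads of the `Fin 2` twins token for token): `hCART` = (d)₂ the Cartan dichotomy on `U(σ_w, Φ₂)(L_w)` (regular, non-compact centraliser ⇒ `g = y t y⁻¹`, `t = diag d`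
regular, `Z(g) = y T y⁻¹`); `hD2a` = (D2a)₂ conjugator control (`g = y t y⁻¹ ∈ Ω_m`, root values `≥ |ϖ^λ|` ⇒ `g = y₀ t y₀⁻¹`, `y₀ ∈ Ω_{2m+2λ}`); `hD2b` = (D2b)₂ support control (`supp θ ⊆ Ω_{m_θ}
⇒ f_t` vanishes off `Ω_{2m_θ+2λ}·T`); `hM5d` = (M5d)₂ Theorem 20 with explicit radius (`∫_{Ω n ∖ Ω (m_C + (1+2s+4m_C) + s)} θ(x (y t y⁻¹) x⁻¹) dμ = 0`).  CONCLUSION: for every `m ∈ M`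
ONE radius `R` such that (i) if `m` is regular, `∫_{Ω n ∖ Ω R} θ_M(x m x⁻¹) dμ = 0` for every `n`; (ii) if `m` is regular with NON-compact centraliser, `R = 5(2m_θ + 2λ) + 3(2m_g + 2λ) + 1`
for a DATUM `(t, d, y₀, λ, m_g)`: `t = diag d` regular, `λ` the MINIMAL depth of `t`, `m_g` the MINIMAL height of `m`, `y₀ ∈ Ω (2m_g + 2λ)`, `m = y₀ t y₀⁻¹`.  Elliptic type: §2
(letter-free); singular: `R := 0`.  The `Fin 2` twin of ★ [M6′] `exists_radius_and_datum`.
[cite: HarishChandra1970, Part VII §2 Theorem 20 p. 70, Cor. of Thm 18 p. 69; §3 p. 71 eq. (1), (ii); Part I §3 Lemma 14 p. 9] [cite: Rogawski1990, §3.6 pp. 28–31, §4.9 p. 54, §12.2 p. 173] -/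
theorem exists_radius_and_datum
    (hCART : ∀ (L' : Type) [Field L'] [NumberField L'] [IsCMField L'] {v' : HeightOneSpectrum (𝓞 ↥(maximalRealSubfield L'))}
      (w' : PlacesOver L' v') (hw' : IsCMField.complexConj L' • w'.1 = w'.1) {J' : Matrix (Fin 2) (Fin 2) (w'.1.adicCompletion L')},
      J' = (StdForm.antidiagonal 2).over (w'.1.adicCompletion L') →
      ∀ {g : ↥(unitaryGroupOfForm (galAdicCompletionMap (L := L') (IsCMField.complexConj L') hw') J')},
      IsRegularElt (g : GL (Fin 2) (w'.1.adicCompletion L')) →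
      ¬ IsCompact ((Subgroup.centralizer ({g} : Set ↥(unitaryGroupOfForm (galAdicCompletionMap (L := L') (IsCMField.complexConj L') hw') J')) :
        Subgroup ↥(unitaryGroupOfForm (galAdicCompletionMap (L := L') (IsCMField.complexConj L') hw') J')) :
          Set ↥(unitaryGroupOfForm (galAdicCompletionMap (L := L') (IsCMField.complexConj L') hw') J')) →
      ∃ (y t : ↥(unitaryGroupOfForm (galAdicCompletionMap (L := L') (IsCMField.complexConj L') hw') J')) (d : Fin 2 → (w'.1.adicCompletion L')ˣ),
        glDiagonal 2 (w'.1.adicCompletion L') d = (t : GL (Fin 2) (w'.1.adicCompletion L')) ∧ IsRegularElt (t : GL (Fin 2) (w'.1.adicCompletion L')) ∧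
        g = y * t * y⁻¹ ∧
        ∀ h : ↥(unitaryGroupOfForm (galAdicCompletionMap (L := L') (IsCMField.complexConj L') hw') J'),
          h ∈ Subgroup.centralizer ({g} : Set ↥(unitaryGroupOfForm (galAdicCompletionMap (L := L') (IsCMField.complexConj L') hw') J')) ↔
            y⁻¹ * h * y ∈ torusU (galAdicCompletionMap (L := L') (IsCMField.complexConj L') hw') J')
    (hD2a : ∀ (K : Type) [Field K] [Valued K ℤᵐ⁰] (σ : K →+* K), (∀ x, Valued.v (σ x) = Valued.v x) → (∀ x, σ (σ x) = x) →
      ∀ {J : Matrix (Fin 2) (Fin 2) K}, J = (StdForm.antidiagonal 2).over K → ∀ {ϖ : K}, Valued.v ϖ = WithZero.exp (-1 : ℤ) →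
      ∀ (Ω : ℕ → Set ↥(unitaryGroupOfForm σ J)),
      (∀ (m : ℕ) (g : ↥(unitaryGroupOfForm σ J)), g ∈ Ω m ↔
        (∀ i j, Valued.v (ϖ ^ m * ((g : GL (Fin 2) K) : Matrix (Fin 2) (Fin 2) K) i j) ≤ 1) ∧
          ∀ i j, Valued.v (ϖ ^ m * (((g : GL (Fin 2) K)⁻¹ : GL (Fin 2) K) : Matrix (Fin 2) (Fin 2) K) i j) ≤ 1) →
      ∀ {g y t : ↥(unitaryGroupOfForm σ J)} {d : Fin 2 → Kˣ}, glDiagonal 2 K d = (t : GL (Fin 2) K) →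
      ∀ {lam : ℕ}, (∀ i k : Fin 2, i ≠ k → Valued.v (ϖ ^ lam) ≤ Valued.v ((d i : K) - d k)) →
      ∀ {m : ℕ}, g ∈ Ω m → g = y * t * y⁻¹ →
      ∃ y₀ : ↥(unitaryGroupOfForm σ J), y₀ ∈ Ω (2 * m + 2 * lam) ∧ g = y₀ * t * y₀⁻¹)
    (hD2b : ∀ (K : Type) [Field K] [Valued K ℤᵐ⁰] (σ : K →+* K), (∀ x, Valued.v (σ x) = Valued.v x) → (∀ x, σ (σ x) = x) →
      ∀ {J : Matrix (Fin 2) (Fin 2) K}, J = (StdForm.antidiagonal 2).over K → ∀ {ϖ : K}, Valued.v ϖ = WithZero.exp (-1 : ℤ) →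
      ∀ (Ω : ℕ → Set ↥(unitaryGroupOfForm σ J)),
      (∀ (m : ℕ) (g : ↥(unitaryGroupOfForm σ J)), g ∈ Ω m ↔
        (∀ i j, Valued.v (ϖ ^ m * ((g : GL (Fin 2) K) : Matrix (Fin 2) (Fin 2) K) i j) ≤ 1) ∧
          ∀ i j, Valued.v (ϖ ^ m * (((g : GL (Fin 2) K)⁻¹ : GL (Fin 2) K) : Matrix (Fin 2) (Fin 2) K) i j) ≤ 1) →
      ∀ {β : Type} [Zero β] (θ : ↥(unitaryGroupOfForm σ J) → β) {mθ : ℕ}, (∀ g, θ g ≠ 0 → g ∈ Ω mθ) →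
      ∀ {t : ↥(unitaryGroupOfForm σ J)} {d : Fin 2 → Kˣ}, glDiagonal 2 K d = (t : GL (Fin 2) K) →
      ∀ {lam : ℕ}, (∀ i k : Fin 2, i ≠ k → Valued.v (ϖ ^ lam) ≤ Valued.v ((d i : K) - d k)) →
      ∀ x : ↥(unitaryGroupOfForm σ J), θ (x * t * x⁻¹) ≠ 0 →
        x ∈ Ω (2 * mθ + 2 * lam) * ((torusU σ J : Subgroup ↥(unitaryGroupOfForm σ J)) : Set ↥(unitaryGroupOfForm σ J)))
    (hM5d : ∀ (K : Type) [Field K] [Valued K ℤᵐ⁰] [ValuativeRel K] [(Valued.v : Valuation K ℤᵐ⁰).Compatible] [IsNonarchimedeanLocalField K]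
      [SecondCountableTopology K] [SecondCountableTopology (GL (Fin 2) K)] [MeasurableSpace K] [BorelSpace K]
      (σ : K →+* K), (∀ x, σ (σ x) = x) → Continuous σ → (∀ x, Valued.v (σ x) = Valued.v x) → (2 : K) ≠ 0 →
      ∀ {J : Matrix (Fin 2) (Fin 2) K}, J = (StdForm.antidiagonal 2).over K →
      ∀ [MeasurableSpace ↥(unitaryGroupOfForm σ J)] [BorelSpace ↥(unitaryGroupOfForm σ J)]
        [SecondCountableTopology ↥(unitaryGroupOfForm σ J)] [LocallyCompactSpace ↥(unitaryGroupOfForm σ J)]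
        (μ : Measure ↥(unitaryGroupOfForm σ J)) [μ.IsHaarMeasure] [μ.IsMulRightInvariant]
        {ϖ : K}, Valued.v ϖ = WithZero.exp (-1 : ℤ) → ∀ {ϖ' : K}, ϖ' ≠ 0 → valuation K ϖ' < 1 → σ ϖ' = ϖ' →
      (∀ z ∈ Subgroup.center ↥(unitaryGroupOfForm σ J), ∃ c : Kˣ,
        ((z : ↥(unitaryGroupOfForm σ J)) : GL (Fin 2) K) = Matrix.GeneralLinearGroup.scalar (Fin 2) c) →
      IsCompact ((Subgroup.center ↥(unitaryGroupOfForm σ J) : Subgroup ↥(unitaryGroupOfForm σ J)) : Set ↥(unitaryGroupOfForm σ J)) →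
      ∀ (Ω : CompactExhaustion ↥(unitaryGroupOfForm σ J)),
      (∀ (m : ℕ) (g : ↥(unitaryGroupOfForm σ J)), g ∈ Ω m ↔
        (∀ i j, Valued.v (ϖ ^ m * ((g : GL (Fin 2) K) : Matrix (Fin 2) (Fin 2) K) i j) ≤ 1) ∧
          ∀ i j, Valued.v (ϖ ^ m * (((g : GL (Fin 2) K)⁻¹ : GL (Fin 2) K) : Matrix (Fin 2) (Fin 2) K) i j) ≤ 1) →
      (∀ (m : ℕ) (g : ↥(unitaryGroupOfForm σ J)), g ∈ Ω m → g⁻¹ ∈ Ω m) →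
      (∀ (a b : ℕ) (g h : ↥(unitaryGroupOfForm σ J)), g ∈ Ω a → h ∈ Ω b → g * h ∈ Ω (a + b)) →
      ∀ {V : Type u} [AddCommGroup V] [Module ℂ V] (ρ : Representation ℂ ↥(unitaryGroupOfForm σ J) V), ρ.IsSmooth → ρ.IsSupercuspidal →
      ∀ (B : V →ₗ⋆[ℂ] V →ₗ[ℂ] ℂ), (∀ (g : ↥(unitaryGroupOfForm σ J)) (x y : V), B (ρ g x) (ρ g y) = B x y) → ∀ (u u' : V)
        (t : ↥(unitaryGroupOfForm σ J)) {d : Fin 2 → Kˣ}, glDiagonal 2 K d = (t : GL (Fin 2) K) → IsRegularElt (t : GL (Fin 2) K) →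
      ∀ (C : Set ↥(unitaryGroupOfForm σ J)) {mC : ℕ}, C ⊆ Ω mC →
      (∀ x : ↥(unitaryGroupOfForm σ J), B u' (ρ (x * t * x⁻¹) u) ≠ 0 →
        x ∈ C * ((torusU σ J : Subgroup ↥(unitaryGroupOfForm σ J)) : Set ↥(unitaryGroupOfForm σ J))) →
      ∀ {s : ℕ} {y : ↥(unitaryGroupOfForm σ J)}, y ∈ Ω s → ∀ n : ℕ,
        ∫ x in Ω n \ Ω (mC + (1 + 2 * s + 4 * mC) + s), B u' (ρ (x * (y * t * y⁻¹) * x⁻¹) u) ∂μ = 0)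
    {J : Matrix (Fin 2) (Fin 2) (w.1.adicCompletion L)}
    (hJ : J = (StdForm.antidiagonal 2).over (w.1.adicCompletion L))
    [MeasurableSpace ↥(unitaryGroupOfForm (galAdicCompletionMap (L := L) (IsCMField.complexConj L) hw) J)]
    [BorelSpace ↥(unitaryGroupOfForm (galAdicCompletionMap (L := L) (IsCMField.complexConj L) hw) J)]
    (μ : Measure ↥(unitaryGroupOfForm (galAdicCompletionMap (L := L) (IsCMField.complexConj L) hw) J)) [μ.IsHaarMeasure]
    (Ω : CompactExhaustion ↥(unitaryGroupOfForm (galAdicCompletionMap (L := L) (IsCMField.complexConj L) hw) J)) {ϖ : w.1.adicCompletion L}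
    (hϖ : Valued.v ϖ = WithZero.exp (-1 : ℤ))
    (hmem : ∀ (m : ℕ) (g : ↥(unitaryGroupOfForm (galAdicCompletionMap (L := L) (IsCMField.complexConj L) hw) J)), g ∈ Ω m ↔
      (∀ i j, Valued.v (ϖ ^ m * ((g : GL (Fin 2) (w.1.adicCompletion L)) : Matrix (Fin 2) (Fin 2) (w.1.adicCompletion L)) i j) ≤ 1) ∧
        ∀ i j, Valued.v (ϖ ^ m * (((g : GL (Fin 2) (w.1.adicCompletion L))⁻¹ : GL (Fin 2) (w.1.adicCompletion L)) :
          Matrix (Fin 2) (Fin 2) (w.1.adicCompletion L)) i j) ≤ 1)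
    (hinv : ∀ (m : ℕ) (g : ↥(unitaryGroupOfForm (galAdicCompletionMap (L := L) (IsCMField.complexConj L) hw) J)), g ∈ Ω m → g⁻¹ ∈ Ω m)
    (hmul : ∀ (a b : ℕ) (g h : ↥(unitaryGroupOfForm (galAdicCompletionMap (L := L) (IsCMField.complexConj L) hw) J)), g ∈ Ω a → h ∈ Ω b → g * h ∈ Ω (a + b))
    {V : Type u} [AddCommGroup V] [Module ℂ V]
    (ρ : Representation ℂ ↥(unitaryGroupOfForm (galAdicCompletionMap (L := L) (IsCMField.complexConj L) hw) J) V) (hsm : ρ.IsSmooth) (hsc : ρ.IsSupercuspidal)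
    (B : V →ₗ⋆[ℂ] V →ₗ[ℂ] ℂ)
    (hBinv : ∀ (g : ↥(unitaryGroupOfForm (galAdicCompletionMap (L := L) (IsCMField.complexConj L) hw) J)) (x y : V), B (ρ g x) (ρ g y) = B x y) (u u' : V)
    {mθ : ℕ} (hθ : ∀ g : ↥(unitaryGroupOfForm (galAdicCompletionMap (L := L) (IsCMField.complexConj L) hw) J), B u' (ρ g u) ≠ 0 → g ∈ Ω mθ)
    (m : ↥(unitaryGroupOfForm (galAdicCompletionMap (L := L) (IsCMField.complexConj L) hw) J)) :
    ∃ R : ℕ,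
      (IsRegularElt (m : GL (Fin 2) (w.1.adicCompletion L)) → ∀ n : ℕ, ∫ x in Ω n \ Ω R, B u' (ρ (x * m * x⁻¹) u) ∂μ = 0) ∧
      (IsRegularElt (m : GL (Fin 2) (w.1.adicCompletion L)) →
        ¬ IsCompact ((Subgroup.centralizer ({m} : Set ↥(unitaryGroupOfForm (galAdicCompletionMap (L := L) (IsCMField.complexConj L) hw) J)) :
          Subgroup ↥(unitaryGroupOfForm (galAdicCompletionMap (L := L) (IsCMField.complexConj L) hw) J)) :
            Set ↥(unitaryGroupOfForm (galAdicCompletionMap (L := L) (IsCMField.complexConj L) hw) J)) →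
        ∃ (t y₀ : ↥(unitaryGroupOfForm (galAdicCompletionMap (L := L) (IsCMField.complexConj L) hw) J)) (d : Fin 2 → (w.1.adicCompletion L)ˣ) (lam mg : ℕ),
          glDiagonal 2 (w.1.adicCompletion L) d = (t : GL (Fin 2) (w.1.adicCompletion L)) ∧ IsRegularElt (t : GL (Fin 2) (w.1.adicCompletion L)) ∧
          (∀ i k : Fin 2, i ≠ k → Valued.v (ϖ ^ lam) ≤ Valued.v ((d i : w.1.adicCompletion L) - d k)) ∧
          (∀ lam' : ℕ, (∀ i k : Fin 2, i ≠ k → Valued.v (ϖ ^ lam') ≤ Valued.v ((d i : w.1.adicCompletion L) - d k)) → lam ≤ lam') ∧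
          m ∈ Ω mg ∧ (∀ m' : ℕ, m ∈ Ω m' → mg ≤ m') ∧
          y₀ ∈ Ω (2 * mg + 2 * lam) ∧ m = y₀ * t * y₀⁻¹ ∧
          R = 5 * (2 * mθ + 2 * lam) + 3 * (2 * mg + 2 * lam) + 1) := by
  by_cases hreg : IsRegularElt (m : GL (Fin 2) (w.1.adicCompletion L))
  swap
  · exact ⟨0, fun h => absurd h hreg, fun h => absurd h hreg⟩
  by_cases hZ : IsCompact ((Subgroup.centralizer ({m} : Set ↥(unitaryGroupOfForm (galAdicCompletionMap (L := L) (IsCMField.complexConj L) hw) J)) :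
      Subgroup ↥(unitaryGroupOfForm (galAdicCompletionMap (L := L) (IsCMField.complexConj L) hw) J)) :
        Set ↥(unitaryGroupOfForm (galAdicCompletionMap (L := L) (IsCMField.complexConj L) hw) J))
  · -- ELLIPTIC: the compact-support radius of §2; no datum owed
    obtain ⟨R, hR⟩ := exists_forall_setIntegral_sdiff_coeff_conj_eq_zero_of_isCompact_centralizer L w hw hJ μ Ω ρ hsm hsc B hBinv u u' m hreg hZ
    exact ⟨R, fun _ => hR, fun _ h => absurd hZ h⟩
  · -- SPLIT: the datum
    -- frame of `L_w` and `M` (★ [M2a] FILE A, N-agnostic heads; ★ [M2a]₂ FILE A; ★ `AdicCompletionLocalField` instances)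
    letI : MeasurableSpace (w.1.adicCompletion L) := borel _
    haveI : BorelSpace (w.1.adicCompletion L) := ⟨rfl⟩
    haveI : SecondCountableTopology (w.1.adicCompletion L) := secondCountableTopology_adicCompletion L w.1
    haveI : CharZero (w.1.adicCompletion L) := charZero_of_injective_algebraMap (algebraMap L (w.1.adicCompletion L)).injective
    haveI : SecondCountableTopology (GL (Fin 2) (w.1.adicCompletion L)) := secondCountableTopology_gl_adicCompletion L 2 w.1
    haveI : SecondCountableTopology ↥(unitaryGroupOfForm (galAdicCompletionMap (L := L) (IsCMField.complexConj L) hw) J) :=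
      K2E3SupercuspModelFrameAtPlace.secondCountableTopology_unitaryGroupOfForm_adicCompletion L w _ J
    haveI : LocallyCompactSpace ↥(unitaryGroupOfForm (galAdicCompletionMap (L := L) (IsCMField.complexConj L) hw) J) :=
      K2E3SupercuspModelFrameAtPlaceTwo.locallyCompactSpace_unitaryGroupOfForm_adicCompletion L w hw J
    haveI : μ.IsMulRightInvariant := K2E3SupercuspModelFrameAtPlaceTwo.isMulRightInvariant_of_isHaarMeasure_of_eq_over L w hw hJ μ
    have hσσ : ∀ x, galAdicCompletionMap (L := L) (IsCMField.complexConj L) hw (galAdicCompletionMap (L := L) (IsCMField.complexConj L) hw x) = x :=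
      galAdicCompletionMap_galAdicCompletionMap_of_smul_eq (IsCMField.complexConj L) w (IsCMField.complexConj_ne_one L) hw
    have hσc : Continuous (galAdicCompletionMap (L := L) (IsCMField.complexConj L) hw) := continuous_galAdicCompletionMap L (IsCMField.complexConj L) hw
    have hσv : ∀ x, Valued.v (galAdicCompletionMap (L := L) (IsCMField.complexConj L) hw x) = Valued.v x :=
      fun x => valued_galAdicCompletionMap (L := L) (IsCMField.complexConj L) hw x
    have hZc := K2E3SupercuspModelFrameAtPlaceTwo.isCompact_center_of_eq_over L w hw hJ
    have hZs := K2E3SupercuspModelFrameAtPlaceTwo.exists_coe_eq_scalar_of_mem_center L w hw hJ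
    obtain ⟨ϖ', hϖ'0, hϖ'1, hσϖ'⟩ := K2E3SupercuspModelFrameAtPlace.exists_ne_zero_valuation_lt_one_map_eq L w hw
    -- the Cartan datum `m = y t y⁻¹` (letter (d)₂)
    obtain ⟨y, t, d, hd, htreg, hmy, -⟩ := hCART L w hw hJ hreg hZ
    have hreg' : IsRegularElt (glDiagonal 2 (w.1.adicCompletion L) d) := by rw [hd]; exact htreg
    -- the MINIMAL depth `λ` and the MINIMAL height `m_g`
    have hex := exists_depth_of_isRegularElt hϖ hreg'
    set lam : ℕ := Nat.find hex with hlam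
    have hlam_spec : ∀ i k : Fin 2, i ≠ k → Valued.v (ϖ ^ lam) ≤ Valued.v ((d i : w.1.adicCompletion L) - d k) := Nat.find_spec hex
    have hlam_min : ∀ lam' : ℕ, (∀ i k : Fin 2, i ≠ k → Valued.v (ϖ ^ lam') ≤ Valued.v ((d i : w.1.adicCompletion L) - d k)) → lam ≤ lam' :=
      fun lam' h => Nat.find_min' hex h
    set mg : ℕ := Ω.find m with hmg
    have hmg_mem : m ∈ Ω mg := Ω.mem_find m
    have hmg_min : ∀ m' : ℕ, m ∈ Ω m' → mg ≤ m' := fun m' h => Ω.mem_iff_find_le.1 h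
    -- the conjugator of controlled height (letter (D2a)₂) and the support datum (letter (D2b)₂)
    obtain ⟨y₀, hy₀, hmy₀⟩ := hD2a (w.1.adicCompletion L) (galAdicCompletionMap (L := L) (IsCMField.complexConj L) hw) hσv hσσ hJ hϖ Ω hmem hd hlam_spec
      hmg_mem hmy
    have hsupp := hD2b (w.1.adicCompletion L) (galAdicCompletionMap (L := L) (IsCMField.complexConj L) hw) hσv hσσ hJ hϖ Ω hmem
      (fun g => B u' (ρ g u)) hθ hd hlam_spec
    -- Theorem 20 with the explicit radius (letter (M5d)₂)
    refine ⟨(2 * mθ + 2 * lam) + (1 + 2 * (2 * mg + 2 * lam) + 4 * (2 * mθ + 2 * lam)) + (2 * mg + 2 * lam), fun _ n => ?_, fun _ _ => ?_⟩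
    · rw [hmy₀]
      exact hM5d (w.1.adicCompletion L) (galAdicCompletionMap (L := L) (IsCMField.complexConj L) hw) hσσ hσc hσv two_ne_zero hJ μ hϖ hϖ'0 hϖ'1 hσϖ' hZs hZc
        Ω hmem hinv hmul ρ hsm hsc B hBinv u u' t hd htreg (Ω (2 * mθ + 2 * lam)) subset_rfl hsupp hy₀ n
    · exact ⟨t, y₀, d, lam, mg, hd, htreg, hlam_spec, hlam_min, hmg_mem, hmg_min, hy₀, hmy₀, by ring⟩

end Model

end Summit.HodgeConjecture.HodgeConjecture.Cruxes.H413.K2E3SupercuspidalTruncatedCharRadiusDatumTwo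

end
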